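import Literature.Topology.FourManifolds.FlowFibreMorseData
import Literature.Topology.FourManifolds.FlowFibreMorseAlgebra
import Literature.Topology.FourManifolds.Isotopy
import HarnessLib

/-!
# The Hessian and the index of `Γ(φ̄, f)` over a critical point of `φ` ("flow rule", second order)

Topic `Literature/Topology/FourManifolds`; step E1c of a Morse-theoretic construction of
Gay–Kirby's trisection for the fact seat
`provefact-Literature.Topology.FourManifolds.exists_isBalancedGKTrisection` (Gay–Kirby 2016,
Thm. 4 via §4, Lemma 14).  Everything in this file is **proved**; no definitions, no named
facts.

Setting of `FlowFibreMorseData.lean`: closed `M^{m+1}`, Morse `f`, smooth gradient-like `ξ`,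
regular level `Y = f⁻¹(a)`, `φ̄ = flowLift φ` the lift of a smooth `φ : Y → ℝ`, and
`Ψ = Γ(φ̄, f)`.  At a point `z₀ = flow y₀ t₀` over a critical point `y₀` of `φ`, where
`∂₂Γ = 0` (so that `z₀` is critical for `Ψ`), read everything in the chart at `z₀` obtained by
**transporting the chart at `y₀` along the time-`t₀` diffeomorphism of the flow**
(`Diffeomorph.transportedChart`): there `Ψ` reads `Γ(φ̄ ∘ e'⁻¹, (f ∘ flow_{t₀}) ∘ e'⁻¹)`
near `e' y₀` (`φ̄` is flow-invariant), so by the second-order chain rule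
(`fderiv_fderiv_comp₂_apply_of_fderiv_eq_zero`)

  `Hess = ∂₂₂Γ · ℓ ⊗ ℓ + ∂₁Γ · Q`,  `ℓ = D((f ∘ flow_{t₀}) ∘ e'⁻¹)(e' y₀)`,
  `Q = D²(φ̄ ∘ e'⁻¹)(e' y₀) = hessianInChart e' φ̄ y₀`

(`hessianInChart_transportedChart_comp₂_apply`).  The chart image `ξ̂` of `ξ y₀` lies in the
radical of `Q` (criticality of `φ̄` propagates along the flow line) and `ℓ ξ̂ > 0`; so over
`ℝξ̂ ⊕ ker ℓ` the form splits (`LinearMap.BilinForm.sigNeg_eq_of_line_ker`), `Q|ker ℓ` is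
congruent to `Q|ker D(f ∘ e'⁻¹)` (`…_of_radical`), whose index is the Morse index of
`φ̄|Y = φ` at `y₀` (`RegularLevel.morseIndex_comp_incl_eq`).  Result
(`morseIndex_comp₂_flow_eq`, `nondegenerate_mhessian_comp₂_flow`): the critical point `z₀` of
`Ψ` is nondegenerate iff `∂₂₂Γ ≠ 0` (given `∂₁Γ ≠ 0` and `φ` Morse), of index
`[∂₂₂Γ < 0] + (index_φ y₀ if ∂₁Γ > 0, m − index_φ y₀ if ∂₁Γ < 0)`.

## References

* J. Milnor, *Morse theory* (1963), §2–§3. [Milnor1963]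
* J. Milnor, *Lectures on the h-cobordism theorem* (1965), Thm. 3.4, Thm. 4.1. [MilnorHCobordism1965]
* D. Gay, R. Kirby, *Trisecting 4-manifolds*, Geom. Topol. 20 (2016), §4, Lemma 14. [GayKirby2016]
-/

open scoped Manifold ContDiff Topology
open Set Function Filter

noncomputable section

universe u

namespace Literature.Topology.FourManifolds

open Flow

/-- Local notation: `𝔼 n` is the model Euclidean space `EuclideanSpace ℝ (Fin n)`. -/
local notation "𝔼 " n:arg => EuclideanSpace ℝ (Fin n)

variable {m : ℕ} {M : Type u} [TopologicalSpace M] [T2Space M] [CompactSpace M]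
  [ChartedSpace (𝔼 (m + 1)) M] [IsManifold (𝓡 (m + 1)) ∞ M]
  {f : M → ℝ} {ξ : Π x : M, TangentSpace (𝓡 (m + 1)) x} {a : ℝ}
  {hξ : ContMDiff (𝓡 (m + 1)) (𝓡 (m + 1)).tangent ∞ fun x => (⟨x, ξ x⟩ : TangentBundle (𝓡 (m + 1)) M)}
  {h : IsRegularLevel (𝓡 (m + 1)) f a}

/-! ### The time-`t₀` diffeomorphism of the flow and the transported chart -/

/-- The time-`t₀` map of the flow as a diffeomorphism of `M`. [cite: LeeSmoothManifolds2013, Thm. 9.12] -/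
abbrev flowDiffeo (hξ : ContMDiff (𝓡 (m + 1)) (𝓡 (m + 1)).tangent ∞ fun x => (⟨x, ξ x⟩ : TangentBundle (𝓡 (m + 1)) M))
    (t₀ : ℝ) : M ≃ₘ⟮𝓡 (m + 1), 𝓡 (m + 1)⟯ M :=
  GlobalFlow.diffeomorph (isSmoothFlow_flow hξ).contMDiff (isSmoothFlow_flow hξ).map_zero
    (isSmoothFlow_flow hξ).map_add t₀

/-- `flowDiffeo t₀ y = flow y t₀`. [folklore] -/
@[simp] theorem flowDiffeo_apply (t₀ : ℝ) (y : M) : flowDiffeo hξ t₀ y = flow hξ y t₀ := rfl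

/-- `(flowDiffeo t₀)⁻¹ w = flow w (-t₀)`. [folklore] -/
@[simp] theorem flowDiffeo_symm_apply (t₀ : ℝ) (w : M) : (flowDiffeo hξ t₀).symm w = flow hξ w (-t₀) := rfl

/-- The transported chart `chartAt y ∘ flow_{-t₀}` at `flow y t₀`, as a map. [folklore] -/
theorem transportedChart_flow_apply (t₀ : ℝ) (y w : M) :
    Diffeomorph.transportedChart (flowDiffeo hξ t₀) y w = chartAt (𝔼 (m + 1)) y (flow hξ w (-t₀)) := by
  simp [Diffeomorph.transportedChart]

/-- The inverse of the transported chart: `u ↦ flow ((chartAt y)⁻¹ u) t₀`. [folklore] -/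
theorem transportedChart_flow_symm_apply (t₀ : ℝ) (y : M) (u : 𝔼 (m + 1)) :
    (Diffeomorph.transportedChart (flowDiffeo hξ t₀) y).symm u = flow hξ ((chartAt (𝔼 (m + 1)) y).symm u) t₀ := by
  simp [Diffeomorph.transportedChart]

/-! ### The radical vector `ξ̂` of the chart Hessian of `φ̄` -/

/-- **`ξ̂` lies in the radical of `D²(φ̄ ∘ e⁻¹)` at a critical point of `φ̄`**: the points of
the flow line through a critical point of `φ̄` are critical, so `D(φ̄ ∘ e⁻¹)` vanishes along
the chart image of the flow line and its derivative along `ξ̂` is zero.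
[cite: MilnorHCobordism1965, Thm. 4.1] [cite: Milnor1963, §2] -/
theorem fderiv_fderiv_flowLift_comp_symm_apply_eq_zero (hgl : IsGradientLike (𝓡 (m + 1)) f ξ)
    (hfM : IsMorse (𝓡 (m + 1)) f) {φ : RegularLevel h → ℝ} (hφ : ContMDiff (𝓡 m) 𝓘(ℝ, ℝ) ∞ φ)
    {e : OpenPartialHomeomorph M (𝔼 (m + 1))} (he : e ∈ IsManifold.maximalAtlas (𝓡 (m + 1)) ∞ M)
    {z : M} (hze : z ∈ e.source) (hz : Hits (flowθ hξ) f a z)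
    (hc : IsMCriticalPt (𝓡 (m + 1)) (flowLift hξ h φ) z) :
    fderiv ℝ (fderiv ℝ (flowLift hξ h φ ∘ e.symm)) (e z)
      (mfderiv (𝓡 (m + 1)) 𝓘(ℝ, 𝔼 (m + 1)) (e.extend (𝓡 (m + 1))) z (ξ z)) = 0 := by
  set g := flowLift hξ h φ ∘ e.symm with hg
  set v : 𝔼 (m + 1) := mfderiv (𝓡 (m + 1)) 𝓘(ℝ, 𝔼 (m + 1)) (e.extend (𝓡 (m + 1))) z (ξ z) with hv
  have hg2 : ContDiffAt ℝ 2 g (e z) := contDiffAt_flowLift_comp_symm hgl hfM hφ he hze hz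
  have hDg : DifferentiableAt ℝ (fderiv ℝ g) (e z) :=
    (hg2.fderiv_right (m := 1) (by norm_num)).differentiableAt (by simp)
  -- the chart curve
  have hext : ∀ w, e.extend (𝓡 (m + 1)) w = e w := fun w => by simp
  have hcurve : HasDerivAt (fun t => e (flow hξ z t)) v 0 := by
    have h0 : flow hξ z 0 ∈ e.source := by rw [flow_zero]; exact hze
    have := hasDerivAt_extend_flow (hξ := hξ) he h0
    rw [flow_zero] at this
    simpa only [hext] using this
  have hz0 : e (flow hξ z 0) = e z := by rw [flow_zero]
  have h1 : HasDerivAt (fun t => fderiv ℝ g (e (flow hξ z t))) (fderiv ℝ (fderiv ℝ g) (e z) v) 0 := by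
    have hD := hDg.hasFDerivAt
    rw [← hz0] at hD
    have := hD.comp_hasDerivAt (0 : ℝ) hcurve
    rwa [hz0] at this
  -- along the flow line the derivative vanishes identically
  have hev : ∀ᶠ t in 𝓝 (0 : ℝ), flow hξ z t ∈ e.source := by
    have : flow hξ z 0 ∈ e.source := by rw [flow_zero]; exact hze
    exact (continuous_flow hξ z).continuousAt.preimage_mem_nhds (e.open_source.mem_nhds this)
  have h2 : HasDerivAt (fun t => fderiv ℝ g (e (flow hξ z t))) 0 0 := by
    have heq : (fun t => fderiv ℝ g (e (flow hξ z t))) =ᶠ[𝓝 0] fun _ => (0 : 𝔼 (m + 1) →L[ℝ] ℝ) := by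
      filter_upwards [hev] with t ht
      have hct : IsMCriticalPt (𝓡 (m + 1)) (flowLift hξ h φ) (flow hξ z t) :=
        (isMCriticalPt_flowLift_flow_iff hgl hfM hφ hz t).2 hc
      have hzt : Hits (flowθ hξ) f a (flow hξ z t) := (isSmoothFlow_flow hξ).hits_apply_iff.2 hz
      have hd : MDifferentiableAt (𝓡 (m + 1)) 𝓘(ℝ, ℝ) (flowLift hξ h φ) (flow hξ z t) :=
        (contMDiffAt_flowLift hgl hfM hφ hzt).mdifferentiableAt (by simp)
      exact (isMCriticalPt_iff_fderiv_comp_symm_eq_zero (contMDiffOn_of_mem_maximalAtlas he)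
        (contMDiffOn_symm_of_mem_maximalAtlas he) ht hd).1 hct
    exact (hasDerivAt_const (0 : ℝ) (0 : 𝔼 (m + 1) →L[ℝ] ℝ)).congr_of_eventuallyEq heq
  exact h1.unique h2

/-- The radical property for both slots (the second derivative is symmetric). [cite: Milnor1963, §2] -/
theorem hessianInChart_flowLift_field (hgl : IsGradientLike (𝓡 (m + 1)) f ξ)
    (hfM : IsMorse (𝓡 (m + 1)) f) {φ : RegularLevel h → ℝ} (hφ : ContMDiff (𝓡 m) 𝓘(ℝ, ℝ) ∞ φ)
    {e : OpenPartialHomeomorph M (𝔼 (m + 1))} (he : e ∈ IsManifold.maximalAtlas (𝓡 (m + 1)) ∞ M)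
    {z : M} (hze : z ∈ e.source) (hz : Hits (flowθ hξ) f a z)
    (hc : IsMCriticalPt (𝓡 (m + 1)) (flowLift hξ h φ) z) (w : 𝔼 (m + 1)) :
    hessianInChart (𝓡 (m + 1)) e (flowLift hξ h φ) z
        (mfderiv (𝓡 (m + 1)) 𝓘(ℝ, 𝔼 (m + 1)) (e.extend (𝓡 (m + 1))) z (ξ z)) w = 0 ∧
      hessianInChart (𝓡 (m + 1)) e (flowLift hξ h φ) z w
        (mfderiv (𝓡 (m + 1)) 𝓘(ℝ, 𝔼 (m + 1)) (e.extend (𝓡 (m + 1))) z (ξ z)) = 0 := by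
  have h0 := fderiv_fderiv_flowLift_comp_symm_apply_eq_zero hgl hfM hφ he hze hz hc
  have hsymm : IsSymmSndFDerivAt ℝ (flowLift hξ h φ ∘ e.symm) (e z) :=
    (contDiffAt_flowLift_comp_symm hgl hfM hφ he hze hz).isSymmSndFDerivAt (by simp)
  constructor
  · rw [RegularLevel.hessianInChart_apply_eq, h0]; rfl
  · rw [RegularLevel.hessianInChart_apply_eq, ← hsymm.eq, h0]; rfl

/-! ### The Hessian of `Γ(φ̄, f)` in the transported chart -/

section Main

variable {φ : RegularLevel h → ℝ} {Γ : ℝ × ℝ → ℝ}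

/-- Points of the level hit it. [folklore] -/
theorem hits_of_level (y : RegularLevel h) : Hits (flowθ hξ) f a y.1 :=
  hits_of_apply_eq (flow_zero hξ y.1) y.2

/-- `(f ∘ flow_{t₀}) ∘ e⁻¹` is `C²` at chart images. [folklore] -/
theorem contDiffAt_comp_flow_comp_symm (hfM : IsMorse (𝓡 (m + 1)) f)
    {e : OpenPartialHomeomorph M (𝔼 (m + 1))} (he : e ∈ IsManifold.maximalAtlas (𝓡 (m + 1)) ∞ M)
    {z : M} (hze : z ∈ e.source) (t₀ : ℝ) :
    ContDiffAt ℝ 2 ((fun w => f (flow hξ w t₀)) ∘ e.symm) (e z) := by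
  have he2 : e ∈ IsManifold.maximalAtlas (𝓡 (m + 1)) 2 M :=
    IsManifold.maximalAtlas_subset_of_le (by norm_cast) he
  have hft : ContMDiffAt (𝓡 (m + 1)) 𝓘(ℝ, ℝ) 2 (fun w => f (flow hξ w t₀)) z :=
    ((hfM.contMDiff.comp (contMDiff_flow_apply hξ t₀)) z).of_le (by norm_cast)
  have := contDiffAt_comp_extend_symm hft he2 hze
  simp only [OpenPartialHomeomorph.extend_coe, OpenPartialHomeomorph.extend_coe_symm,
    modelWithCornersSelf_coe, modelWithCornersSelf_coe_symm, CompTriple.comp_eq] at this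
  exact this

/-- **The chart Hessian of `Ψ = Γ(φ̄, f)` at `z₀ = flow y₀ t₀` in the transported chart**,
over a critical point `y₀` of `φ` and with `∂₂Γ(φ y₀, f z₀) = 0`:
`Hess(v, w) = ∂₂₂Γ · ℓ v · ℓ w + ∂₁Γ · Q(v, w)` with `ℓ = D((f ∘ flow_{t₀}) ∘ e'⁻¹)(e' y₀)` and
`Q` the chart Hessian of `φ̄` at `y₀` in `e' = chartAt y₀` (second-order chain rule; `φ̄` is
flow-invariant, so `Ψ ∘ ẽ⁻¹ = Γ(φ̄ ∘ e'⁻¹, (f ∘ flow_{t₀}) ∘ e'⁻¹)` near `e' y₀`).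
[cite: Milnor1963, §2] [cite: GayKirby2016, §4, Lemma 14] -/
theorem hessianInChart_transportedChart_comp₂_apply (hgl : IsGradientLike (𝓡 (m + 1)) f ξ)
    (hfM : IsMorse (𝓡 (m + 1)) f) (hφ : ContMDiff (𝓡 m) 𝓘(ℝ, ℝ) ∞ φ) (y₀ : RegularLevel h) (t₀ : ℝ)
    (hy₀ : IsMCriticalPt (𝓡 m) φ y₀)
    (hΓ : ContDiffAt ℝ 2 Γ (φ y₀, f (flow hξ y₀.1 t₀)))
    (h2 : fderiv ℝ Γ (φ y₀, f (flow hξ y₀.1 t₀)) (0, 1) = 0) (v w : 𝔼 (m + 1)) :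
    hessianInChart (𝓡 (m + 1)) (Diffeomorph.transportedChart (flowDiffeo hξ t₀) y₀.1)
        (fun x => Γ (flowLift hξ h φ x, f x)) (flow hξ y₀.1 t₀) v w =
      fderiv ℝ (fderiv ℝ Γ) (φ y₀, f (flow hξ y₀.1 t₀)) (0, 1) (0, 1) *
          fderiv ℝ ((fun x => f (flow hξ x t₀)) ∘ (chartAt (𝔼 (m + 1)) y₀.1).symm)
            (chartAt (𝔼 (m + 1)) y₀.1 y₀.1) v *
          fderiv ℝ ((fun x => f (flow hξ x t₀)) ∘ (chartAt (𝔼 (m + 1)) y₀.1).symm)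
            (chartAt (𝔼 (m + 1)) y₀.1 y₀.1) w +
        fderiv ℝ Γ (φ y₀, f (flow hξ y₀.1 t₀)) (1, 0) *
          hessianInChart (𝓡 (m + 1)) (chartAt (𝔼 (m + 1)) y₀.1) (flowLift hξ h φ) y₀.1 v w := by
  set e' := chartAt (𝔼 (m + 1)) y₀.1 with he'def
  set eT := Diffeomorph.transportedChart (flowDiffeo hξ t₀) y₀.1 with heTdef
  set z₀ := flow hξ y₀.1 t₀ with hz₀
  set F := flowLift hξ h φ with hFdef
  set g : 𝔼 (m + 1) → ℝ := F ∘ e'.symm with hgdef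
  set k : 𝔼 (m + 1) → ℝ := (fun x => f (flow hξ x t₀)) ∘ e'.symm with hkdef
  have he' : e' ∈ IsManifold.maximalAtlas (𝓡 (m + 1)) ∞ M := IsManifold.chart_mem_maximalAtlas y₀.1
  have hye' : y₀.1 ∈ e'.source := mem_chart_source _ y₀.1
  have hy : Hits (flowθ hξ) f a y₀.1 := hits_of_level y₀
  -- the point
  have heTz : eT z₀ = e' y₀.1 := by
    rw [heTdef, transportedChart_flow_apply, hz₀, flow_neg_flow]
  -- the written function, near `e' y₀`
  have hfun : (fun x => Γ (F x, f x)) ∘ eT.symm =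
      fun u => Γ (F (flow hξ (e'.symm u) t₀), f (flow hξ (e'.symm u) t₀)) := by
    funext u
    simp only [comp_apply, heTdef, transportedChart_flow_symm_apply]
    rfl
  have hev : (fun x => Γ (F x, f x)) ∘ eT.symm =ᶠ[𝓝 (e' y₀.1)] fun u => Γ (g u, k u) := by
    rw [hfun]
    have h1 : ContinuousAt e'.symm (e' y₀.1) := e'.continuousAt_symm (e'.map_source hye')
    have h2 : ∀ᶠ u in 𝓝 (e' y₀.1), Hits (flowθ hξ) f a (e'.symm u) := by
      have : ∀ᶠ x in 𝓝 (e'.symm (e' y₀.1)), Hits (flowθ hξ) f a x := by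
        rw [e'.left_inv hye']
        exact (hgl.isOpen_setOf_hits hfM hξ h.forall_not_isMCriticalPt).mem_nhds hy
      exact h1.eventually this
    filter_upwards [h2] with u hu
    simp only [hgdef, hkdef, comp_apply]
    rw [show F (flow hξ (e'.symm u) t₀) = F (e'.symm u) from flowLift_flow hgl hfM φ hu t₀]
  -- values at the point
  have hgu : g (e' y₀.1) = φ y₀ := by
    simp only [hgdef, comp_apply, e'.left_inv hye', hFdef, flowLift_apply hgl hfM φ y₀]
  have hku : k (e' y₀.1) = f z₀ := by
    simp only [hkdef, comp_apply, e'.left_inv hye', hz₀]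
  -- hypotheses of the second-order chain rule
  have hg2 : ContDiffAt ℝ 2 g (e' y₀.1) := contDiffAt_flowLift_comp_symm hgl hfM hφ he' hye' hy
  have hk2 : ContDiffAt ℝ 2 k (e' y₀.1) := contDiffAt_comp_flow_comp_symm hfM he' hye' t₀
  have hΓ' : ContDiffAt ℝ 2 Γ (g (e' y₀.1), k (e' y₀.1)) := by rw [hgu, hku]; exact hΓ
  have hcrit : IsMCriticalPt (𝓡 (m + 1)) F y₀.1 :=
    (isMCriticalPt_flowLift_iff_of_level hgl hfM hφ y₀).2 hy₀
  have hg0 : fderiv ℝ g (e' y₀.1) = 0 :=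
    (isMCriticalPt_iff_fderiv_comp_symm_eq_zero (contMDiffOn_of_mem_maximalAtlas he')
      (contMDiffOn_symm_of_mem_maximalAtlas he') hye'
      ((contMDiffAt_flowLift hgl hfM hφ hy).mdifferentiableAt (by simp))).1 hcrit
  have hΓ2 : partialSnd Γ (g (e' y₀.1), k (e' y₀.1)) = 0 := by
    rw [hgu, hku]; exact h2
  -- compute
  rw [RegularLevel.hessianInChart_apply_eq, heTz, (hev.fderiv).fderiv_eq,
    fderiv_fderiv_comp₂_apply_of_fderiv_eq_zero hΓ' hg2 hk2 hg0 hΓ2 v w, hgu, hku]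
  -- `D²Γ (0, s) (0, t) = s t D²Γ (0,1) (0,1)`
  have hsmul : ∀ s t : ℝ, fderiv ℝ (fderiv ℝ Γ) (φ y₀, f z₀) (0, s) (0, t) =
      s * t * fderiv ℝ (fderiv ℝ Γ) (φ y₀, f z₀) (0, 1) (0, 1) := by
    intro s t
    have hs : ((0 : ℝ), s) = s • ((0 : ℝ), (1 : ℝ)) := by ext <;> simp
    have ht : ((0 : ℝ), t) = t • ((0 : ℝ), (1 : ℝ)) := by ext <;> simp
    rw [hs, ht]
    simp only [map_smul, FunLike.coe_smul, Pi.smul_apply, smul_eq_mul]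
    ring
  rw [hsmul, RegularLevel.hessianInChart_apply_eq]
  simp only [partialFst]
  ring

/-! ### Index and nondegeneracy -/

/-- The kernel of a linear functional on `ℝᵐ⁺¹` not vanishing on some vector has dimension `m`.
[folklore] -/
theorem finrank_ker_of_apply_ne_zero (ℓ : 𝔼 (m + 1) →ₗ[ℝ] ℝ) {v : 𝔼 (m + 1)} (hv : ℓ v ≠ 0) :
    Module.finrank ℝ (LinearMap.ker ℓ) = m := by
  have hrange : LinearMap.range ℓ = ⊤ := by
    rw [LinearMap.range_eq_top]
    intro r
    refine ⟨(r / ℓ v) • v, ?_⟩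
    rw [map_smul, smul_eq_mul, div_mul_cancel₀ _ hv]
  have hsum := LinearMap.finrank_range_add_finrank_ker ℓ
  rw [hrange, finrank_top, Module.finrank_self, finrank_euclideanSpace_fin] at hsum
  omega

/-- **The flow rule, second order.**  At `z₀ = flow y₀ t₀` over a critical point `y₀` of the
Morse function `φ`, with `∂₂Γ = 0` and `∂₁Γ ≠ 0` at `(φ y₀, f z₀)`: the critical point `z₀` of
`Ψ = Γ(φ̄, f)` is nondegenerate iff `∂₂₂Γ ≠ 0`, and then
`index_Ψ z₀ = [∂₂₂Γ < 0] + (index_φ y₀ if ∂₁Γ > 0, m − index_φ y₀ if ∂₁Γ < 0)`.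
[cite: Milnor1963, §2–§3] [cite: GayKirby2016, §4, Lemma 14] -/
theorem nondegenerate_iff_and_morseIndex_comp₂_flow (hgl : IsGradientLike (𝓡 (m + 1)) f ξ)
    (hfM : IsMorse (𝓡 (m + 1)) f) (hφM : IsMorse (𝓡 m) φ) (y₀ : RegularLevel h) (t₀ : ℝ)
    (hy₀ : IsMCriticalPt (𝓡 m) φ y₀)
    (hΓ : ContDiffAt ℝ 2 Γ (φ y₀, f (flow hξ y₀.1 t₀)))
    (h2 : fderiv ℝ Γ (φ y₀, f (flow hξ y₀.1 t₀)) (0, 1) = 0)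
    (h1 : fderiv ℝ Γ (φ y₀, f (flow hξ y₀.1 t₀)) (1, 0) ≠ 0) :
    ((mhessian (𝓡 (m + 1)) (fun x => Γ (flowLift hξ h φ x, f x)) (flow hξ y₀.1 t₀)).Nondegenerate ↔
        fderiv ℝ (fderiv ℝ Γ) (φ y₀, f (flow hξ y₀.1 t₀)) (0, 1) (0, 1) ≠ 0) ∧
      (fderiv ℝ (fderiv ℝ Γ) (φ y₀, f (flow hξ y₀.1 t₀)) (0, 1) (0, 1) ≠ 0 →
        morseIndex (𝓡 (m + 1)) (fun x => Γ (flowLift hξ h φ x, f x)) (flow hξ y₀.1 t₀) =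
          (if fderiv ℝ (fderiv ℝ Γ) (φ y₀, f (flow hξ y₀.1 t₀)) (0, 1) (0, 1) < 0 then 1 else 0) +
            (if 0 < fderiv ℝ Γ (φ y₀, f (flow hξ y₀.1 t₀)) (1, 0) then morseIndex (𝓡 m) φ y₀
              else m - morseIndex (𝓡 m) φ y₀)) := by
  have hφ : ContMDiff (𝓡 m) 𝓘(ℝ, ℝ) ∞ φ := hφM.contMDiff
  set e' := chartAt (𝔼 (m + 1)) y₀.1 with he'def
  set eT := Diffeomorph.transportedChart (flowDiffeo hξ t₀) y₀.1 with heTdef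
  set z₀ := flow hξ y₀.1 t₀ with hz₀
  set k : 𝔼 (m + 1) → ℝ := (fun x => f (flow hξ x t₀)) ∘ e'.symm with hkdef
  set ℓ : 𝔼 (m + 1) →ₗ[ℝ] ℝ := ((fderiv ℝ k (e' y₀.1) : 𝔼 (m + 1) →L[ℝ] ℝ) : 𝔼 (m + 1) →ₗ[ℝ] ℝ) with hℓdef
  set ℓ₀ : 𝔼 (m + 1) →ₗ[ℝ] ℝ :=
    ((fderiv ℝ (f ∘ e'.symm) (e' y₀.1) : 𝔼 (m + 1) →L[ℝ] ℝ) : 𝔼 (m + 1) →ₗ[ℝ] ℝ) with hℓ₀def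
  set Q : LinearMap.BilinForm ℝ (𝔼 (m + 1)) := hessianInChart (𝓡 (m + 1)) e' (flowLift hξ h φ) y₀.1 with hQdef
  set B : LinearMap.BilinForm ℝ (𝔼 (m + 1)) :=
    hessianInChart (𝓡 (m + 1)) eT (fun x => Γ (flowLift hξ h φ x, f x)) z₀ with hBdef
  set vξ : 𝔼 (m + 1) := mfderiv (𝓡 (m + 1)) 𝓘(ℝ, 𝔼 (m + 1)) (e'.extend (𝓡 (m + 1))) y₀.1 (ξ y₀.1) with hξdef
  have he' : e' ∈ IsManifold.maximalAtlas (𝓡 (m + 1)) ∞ M := IsManifold.chart_mem_maximalAtlas y₀.1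
  have hye' : y₀.1 ∈ e'.source := mem_chart_source _ y₀.1
  have hy : Hits (flowθ hξ) f a y₀.1 := hits_of_level y₀
  have hz : Hits (flowθ hξ) f a z₀ := (isSmoothFlow_flow hξ).hits_apply_iff.2 hy
  have heT : eT ∈ IsManifold.maximalAtlas (𝓡 (m + 1)) ∞ M :=
    Diffeomorph.transportedChart_mem_maximalAtlas (flowDiffeo hξ t₀) y₀.1
  have heT2 : eT ∈ IsManifold.maximalAtlas (𝓡 (m + 1)) 2 M :=
    IsManifold.maximalAtlas_subset_of_le (by norm_cast) heT
  have hzeT : z₀ ∈ eT.source := Diffeomorph.mem_transportedChart_source (flowDiffeo hξ t₀) y₀.1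
  -- `φ̄` at `z₀`, `y₀`
  have hFy : flowLift hξ h φ y₀.1 = φ y₀ := flowLift_apply hgl hfM φ y₀
  have hFz : flowLift hξ h φ z₀ = φ y₀ := by
    rw [hz₀, flowLift_flow hgl hfM φ hy t₀]; exact hFy
  have hcritFy : IsMCriticalPt (𝓡 (m + 1)) (flowLift hξ h φ) y₀.1 :=
    (isMCriticalPt_flowLift_iff_of_level hgl hfM hφ y₀).2 hy₀
  have hcritFz : IsMCriticalPt (𝓡 (m + 1)) (flowLift hξ h φ) z₀ :=
    (isMCriticalPt_flowLift_flow_iff hgl hfM hφ hy t₀).2 hcritFy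
  -- `Ψ` is `C²` and critical at `z₀`
  have hΓz : ContDiffAt ℝ 2 Γ (flowLift hξ h φ z₀, f z₀) := by rw [hFz]; exact hΓ
  have hΨ2 : ContMDiffAt (𝓡 (m + 1)) 𝓘(ℝ, ℝ) 2 (fun x => Γ (flowLift hξ h φ x, f x)) z₀ :=
    contMDiffAt_comp₂ hgl hfM hφ (by norm_cast) hz hΓz
  have hπz : (⟨levelProj hξ f a z₀, apply_levelProj hξ hz⟩ : RegularLevel h) = y₀ := by
    apply Subtype.ext
    show levelProj hξ f a z₀ = y₀.1
    rw [hz₀, hgl.levelProj_flow hfM hξ h.forall_not_isMCriticalPt hy t₀,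
      hgl.levelProj_of_apply_eq hfM hξ h.forall_not_isMCriticalPt y₀.2]
  have hΨcrit : IsMCriticalPt (𝓡 (m + 1)) (fun x => Γ (flowLift hξ h φ x, f x)) z₀ := by
    refine (isMCriticalPt_comp₂_iff hgl hfM hφ hz (hΓz.of_le (by norm_num))).2 ⟨?_, Or.inr ?_⟩
    · rw [hFz]; exact h2
    · rw [hπz]; exact hy₀
  -- the Hessian formula
  have hB : ∀ v w, B v w = fderiv ℝ (fderiv ℝ Γ) (φ y₀, f z₀) (0, 1) (0, 1) * ℓ v * ℓ w +
      fderiv ℝ Γ (φ y₀, f z₀) (1, 0) * Q v w := fun v w =>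
    hessianInChart_transportedChart_comp₂_apply hgl hfM hφ y₀ t₀ hy₀ hΓ h2 v w
  -- properties of `Q`
  have hg2 : ContDiffAt ℝ 2 (flowLift hξ h φ ∘ e'.symm) (e' y₀.1) :=
    contDiffAt_flowLift_comp_symm hgl hfM hφ he' hye' hy
  have hQsymm : ∀ v w, Q v w = Q w v := fun v w => by
    simp only [hQdef, RegularLevel.hessianInChart_apply_eq]
    exact (hg2.isSymmSndFDerivAt (by simp)).eq v w
  have hQξ : ∀ w, Q vξ w = 0 ∧ Q w vξ = 0 := fun w =>
    hessianInChart_flowLift_field hgl hfM hφ he' hye' hy hcritFy w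
  -- `ℓ vξ > 0`, `ℓ₀ vξ ≠ 0`
  have hk2 : ContDiffAt ℝ 2 k (e' y₀.1) := contDiffAt_comp_flow_comp_symm hfM he' hye' t₀
  have hℓξ : ℓ vξ = mlineDeriv (𝓡 (m + 1)) f z₀ (ξ z₀) :=
    fderiv_comp_flow_comp_symm_apply_eq hfM he' hye' t₀ (hk2.differentiableAt (by norm_num))
  have hℓξpos : 0 < ℓ vξ := by rw [hℓξ]; exact mlineDeriv_pos_of_hits h hgl hz
  have hℓξne : ℓ vξ ≠ 0 := hℓξpos.ne'
  have hℓ₀ξ : ℓ₀ vξ = mlineDeriv (𝓡 (m + 1)) f y₀.1 (ξ y₀.1) :=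
    fderiv_comp_symm_apply_eq_mlineDeriv (hξ := hξ) hfM he' hye'
  have hℓ₀ξne : ℓ₀ vξ ≠ 0 := by rw [hℓ₀ξ]; exact (mlineDeriv_pos_of_hits h hgl hy).ne'
  -- block structure of `B`
  have hBsymm : B.IsSymm := ⟨fun v w => by rw [hB, hB, hQsymm]; ring⟩
  have hcross : ∀ w ∈ LinearMap.ker ℓ, B vξ w = 0 ∧ B w vξ = 0 := fun w hw => by
    rw [LinearMap.mem_ker] at hw
    rw [hB, hB, hw, (hQξ w).1, (hQξ w).2]
    constructor <;> ring
  have hBξ : B vξ vξ = fderiv ℝ (fderiv ℝ Γ) (φ y₀, f z₀) (0, 1) (0, 1) * (ℓ vξ * ℓ vξ) := by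
    rw [hB, (hQξ vξ).1]; ring
  have hres : B.restrict (LinearMap.ker ℓ) = fderiv ℝ Γ (φ y₀, f z₀) (1, 0) • Q.restrict (LinearMap.ker ℓ) := by
    refine LinearMap.ext fun x => LinearMap.ext fun y => ?_
    have hx : ℓ x = 0 := LinearMap.mem_ker.1 x.2
    simp only [LinearMap.BilinForm.restrict_apply, LinearMap.domRestrict_apply, LinearMap.smul_apply,
      hB, hx, zero_mul, mul_zero, zero_add, smul_eq_mul]
  -- the restricted `Q`
  set R : LinearMap.BilinForm ℝ (LinearMap.ker ℓ) := Q.restrict (LinearMap.ker ℓ) with hRdef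
  have hRsymm : R.IsSymm := ⟨fun x y => by
    simp only [hRdef, LinearMap.BilinForm.restrict_apply, LinearMap.domRestrict_apply]; exact hQsymm _ _⟩
  have hF2 : ContMDiffAt (𝓡 (m + 1)) 𝓘(ℝ, ℝ) 2 (flowLift hξ h φ) y₀.1 :=
    (contMDiffAt_flowLift hgl hfM hφ hy).of_le (by norm_cast)
  have hidxR : sigNeg R.toQuadraticMap = morseIndex (𝓡 m) φ y₀ := by
    rw [hRdef, LinearMap.BilinForm.sigNeg_restrict_ker_eq_of_radical Q hQξ hℓξne hℓ₀ξne,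
      ← RegularLevel.morseIndex_comp_incl_eq y₀ hF2 hcritFy he' hye', flowLift_comp_incl hgl hfM φ]
  have hRnd : R.Nondegenerate := by
    rw [hRdef, LinearMap.BilinForm.nondegenerate_restrict_ker_iff_of_radical Q hQξ hℓξne hℓ₀ξne,
      ← RegularLevel.nondegenerate_mhessian_comp_incl_iff y₀ hF2 hcritFy he' hye',
      flowLift_comp_incl hgl hfM φ]
    exact hφM.nondegenerate hy₀
  have hdim : Module.finrank ℝ (LinearMap.ker ℓ) = m := finrank_ker_of_apply_ne_zero ℓ hℓξne
  -- the Hessian of `Ψ` versus `B`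
  have hnd : (mhessian (𝓡 (m + 1)) (fun x => Γ (flowLift hξ h φ x, f x)) z₀).Nondegenerate ↔
      B.Nondegenerate :=
    nondegenerate_mhessian_iff hΨ2 hΨcrit heT2 hzeT
  have hidx : morseIndex (𝓡 (m + 1)) (fun x => Γ (flowLift hξ h φ x, f x)) z₀ = sigNeg B.toQuadraticMap :=
    morseIndex_eq_sigNeg_hessianInChart hΨ2 hΨcrit heT2 hzeT
  have hβ : fderiv ℝ Γ (φ y₀, f z₀) (1, 0) ≠ 0 := h1
  constructor
  · rw [hnd, B.nondegenerate_iff_of_line_ker (ξ := vξ) (ℓ := ℓ) hℓξne hcross, hBξ, hres,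
      LinearMap.BilinForm.nondegenerate_smul_iff _ hβ]
    constructor
    · rintro ⟨hα, -⟩ hα0
      exact hα (by rw [hα0, zero_mul])
    · intro hα
      exact ⟨mul_ne_zero hα (mul_ne_zero hℓξne hℓξne), hRnd⟩
  · intro hα
    rw [hidx, B.sigNeg_eq_of_line_ker hBsymm (ξ := vξ) (ℓ := ℓ) hℓξne hcross, hBξ, hres]
    have hsq : 0 < ℓ vξ * ℓ vξ := mul_pos hℓξpos hℓξpos
    have hiff : fderiv ℝ (fderiv ℝ Γ) (φ y₀, f z₀) (0, 1) (0, 1) * (ℓ vξ * ℓ vξ) < 0 ↔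
        fderiv ℝ (fderiv ℝ Γ) (φ y₀, f z₀) (0, 1) (0, 1) < 0 := by
      constructor
      · intro hlt
        by_contra hge
        have hge' : 0 ≤ fderiv ℝ (fderiv ℝ Γ) (φ y₀, f z₀) (0, 1) (0, 1) := not_lt.1 hge
        nlinarith [mul_nonneg hge' hsq.le]
      · intro hlt; nlinarith
    simp only [hiff]
    congr 1
    rcases lt_or_gt_of_ne hβ with hβneg | hβpos
    · have hsum := LinearMap.BilinForm.sigNeg_smul_of_neg hRnd hRsymm hβneg
      rw [hdim, hidxR] at hsum
      rw [if_neg (not_lt.2 hβneg.le)]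
      omega
    · rw [LinearMap.BilinForm.sigNeg_smul_of_pos' R hβpos, hidxR, if_pos hβpos]

/-- **Nondegeneracy of `Γ(φ̄, f)` over a critical point of `φ`** (`∂₂Γ = 0`, `∂₁Γ ≠ 0`,
`φ` Morse): iff `∂₂₂Γ ≠ 0`. [cite: Milnor1963, §2] [cite: GayKirby2016, §4, Lemma 14] -/
theorem nondegenerate_mhessian_comp₂_flow_iff (hgl : IsGradientLike (𝓡 (m + 1)) f ξ)
    (hfM : IsMorse (𝓡 (m + 1)) f) (hφM : IsMorse (𝓡 m) φ) (y₀ : RegularLevel h) (t₀ : ℝ)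
    (hy₀ : IsMCriticalPt (𝓡 m) φ y₀)
    (hΓ : ContDiffAt ℝ 2 Γ (φ y₀, f (flow hξ y₀.1 t₀)))
    (h2 : fderiv ℝ Γ (φ y₀, f (flow hξ y₀.1 t₀)) (0, 1) = 0)
    (h1 : fderiv ℝ Γ (φ y₀, f (flow hξ y₀.1 t₀)) (1, 0) ≠ 0) :
    (mhessian (𝓡 (m + 1)) (fun x => Γ (flowLift hξ h φ x, f x)) (flow hξ y₀.1 t₀)).Nondegenerate ↔
      fderiv ℝ (fderiv ℝ Γ) (φ y₀, f (flow hξ y₀.1 t₀)) (0, 1) (0, 1) ≠ 0 :=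
  (nondegenerate_iff_and_morseIndex_comp₂_flow hgl hfM hφM y₀ t₀ hy₀ hΓ h2 h1).1

/-- **The index of `Γ(φ̄, f)` over a critical point of `φ`** (`∂₂Γ = 0`, `∂₁Γ ≠ 0`, `∂₂₂Γ ≠ 0`,
`φ` Morse): `[∂₂₂Γ < 0] + (index_φ y₀ if ∂₁Γ > 0, m − index_φ y₀ if ∂₁Γ < 0)`.  For the sector
function `1 − C·U(s)V(v)w(φ̄)` of the trisection this gives: one critical point over each
critical point of the Heegaard function in `H`, of the same index.
[cite: Milnor1963, §2–§3] [cite: GayKirby2016, §4, Lemma 14] -/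
theorem morseIndex_comp₂_flow_eq (hgl : IsGradientLike (𝓡 (m + 1)) f ξ)
    (hfM : IsMorse (𝓡 (m + 1)) f) (hφM : IsMorse (𝓡 m) φ) (y₀ : RegularLevel h) (t₀ : ℝ)
    (hy₀ : IsMCriticalPt (𝓡 m) φ y₀)
    (hΓ : ContDiffAt ℝ 2 Γ (φ y₀, f (flow hξ y₀.1 t₀)))
    (h2 : fderiv ℝ Γ (φ y₀, f (flow hξ y₀.1 t₀)) (0, 1) = 0)
    (h1 : fderiv ℝ Γ (φ y₀, f (flow hξ y₀.1 t₀)) (1, 0) ≠ 0)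
    (h22 : fderiv ℝ (fderiv ℝ Γ) (φ y₀, f (flow hξ y₀.1 t₀)) (0, 1) (0, 1) ≠ 0) :
    morseIndex (𝓡 (m + 1)) (fun x => Γ (flowLift hξ h φ x, f x)) (flow hξ y₀.1 t₀) =
      (if fderiv ℝ (fderiv ℝ Γ) (φ y₀, f (flow hξ y₀.1 t₀)) (0, 1) (0, 1) < 0 then 1 else 0) +
        (if 0 < fderiv ℝ Γ (φ y₀, f (flow hξ y₀.1 t₀)) (1, 0) then morseIndex (𝓡 m) φ y₀
          else m - morseIndex (𝓡 m) φ y₀) :=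
  (nondegenerate_iff_and_morseIndex_comp₂_flow hgl hfM hφM y₀ t₀ hy₀ hΓ h2 h1).2 h22

/-- **Criticality over a critical point of `φ`**: with `∂₂Γ(φ y₀, f z₀) = 0`, the point
`z₀ = flow y₀ t₀` is a critical point of `Γ(φ̄, f)`. [cite: GayKirby2016, §4, Lemma 14] -/
theorem isMCriticalPt_comp₂_flow (hgl : IsGradientLike (𝓡 (m + 1)) f ξ)
    (hfM : IsMorse (𝓡 (m + 1)) f) (hφ : ContMDiff (𝓡 m) 𝓘(ℝ, ℝ) ∞ φ) (y₀ : RegularLevel h) (t₀ : ℝ)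
    (hy₀ : IsMCriticalPt (𝓡 m) φ y₀)
    (hΓ : ContDiffAt ℝ 1 Γ (φ y₀, f (flow hξ y₀.1 t₀)))
    (h2 : fderiv ℝ Γ (φ y₀, f (flow hξ y₀.1 t₀)) (0, 1) = 0) :
    IsMCriticalPt (𝓡 (m + 1)) (fun x => Γ (flowLift hξ h φ x, f x)) (flow hξ y₀.1 t₀) := by
  have hy : Hits (flowθ hξ) f a y₀.1 := hits_of_level y₀
  have hz : Hits (flowθ hξ) f a (flow hξ y₀.1 t₀) := (isSmoothFlow_flow hξ).hits_apply_iff.2 hy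
  have hFz : flowLift hξ h φ (flow hξ y₀.1 t₀) = φ y₀ := by
    rw [flowLift_flow hgl hfM φ hy t₀]; exact flowLift_apply hgl hfM φ y₀
  have hπz : (⟨levelProj hξ f a (flow hξ y₀.1 t₀), apply_levelProj hξ hz⟩ : RegularLevel h) = y₀ := by
    apply Subtype.ext
    show levelProj hξ f a (flow hξ y₀.1 t₀) = y₀.1
    rw [hgl.levelProj_flow hfM hξ h.forall_not_isMCriticalPt hy t₀,
      hgl.levelProj_of_apply_eq hfM hξ h.forall_not_isMCriticalPt y₀.2]
  have hΓz : ContDiffAt ℝ 1 Γ (flowLift hξ h φ (flow hξ y₀.1 t₀), f (flow hξ y₀.1 t₀)) := by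
    rw [hFz]; exact hΓ
  refine (isMCriticalPt_comp₂_iff hgl hfM hφ hz hΓz).2 ⟨?_, Or.inr ?_⟩
  · rw [hFz]; exact h2
  · rw [hπz]; exact hy₀

end Main

end Literature.Topology.FourManifolds

end
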